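import Summits.CriticalPhenomena.PercolationContinuityZ3.Theorems.PercAnnulusCrossingIICTwoPointLower
import Summits.CriticalPhenomena.PercolationContinuityZ3.Theorems.PercAnnulusCrossingIICGluedAnnuliExponential
import Summits.CriticalPhenomena.PercolationContinuityZ3.Theorems.PercAnnulusCrossingIICCondFatZ3OfNonCrossing
import HarnessLib

/-!
# `ℤ³` under robust annulus-uniqueness and X_B: the two-point function and glued annuli of Kesten's IIC (lane RSW3, p1 gen 18)

builds on p205010 (kernel theorem, internal audit signed; external expert review pending) — NOT used in this file.

RSW3 lane (LANE 3 `prim-rsw3`), seat `prim-rsw3-p1` (gen 18).  Helper file (`--supports stmt-CriticalPhenomena-4575`);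
no definitions, no sorries.  Memo `run/shared/lean/prim/rsw3/P1-QM.md` §31.

The `ℤ³` forms of gen 18's conditional theorems with every hypothesis a statement about critical annuli of ONE bounded aspect:
`CU⁺_l(c_U)` (robust conditional annulus-uniqueness at aspect `l`) and X_B = `CritAnnulusNonCrossing` (stmt-0846), using gen 17's
`CU⁺_l ⇒ (A2)□(l,l²)` and `X_B ⇒ UAD`.

* **`exists_le_iicMeasure_real_openConn_Z3_of_robustCondAnnulusUniq_of_critAnnulusNonCrossing`** — `CU⁺_l` + X_B ⇒ `c·π_{p_c}(2n) ≤ ν(0 ↔ z in Λ(2ln))`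
  for `‖z‖_∞ = n ≥ n₀`: with gen 7, **the two-point function of the IIC of `ℤ³` is `≍ π_{p_c}(‖z‖)`**;
* **`iicMeasure_real_iInter_compl_annulusUniq_le_pow_Z3`** — `CU⁺_l(c)` alone ⇒ `ν(⋂_{i<j} U(a_i, la_i)ᶜ) ≤ (1 − c)^j` for nested scales:
  runs of non-glued annuli in the IIC of `ℤ³` are exponentially rare.
References: H. Kesten, PTRF 73 (1986); D. Basu, A. Sapozhnikov, ECP 22 (2017).
-/

noncomputable section

namespace Summit.CriticalPhenomena.PercolationContinuityZ3.Theorems.Crossing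

open MeasureTheory Filter Topology Literature.Probability.Percolation Literature.Probability.LatticeModels
open Literature.Probability.Percolation.DCT16
open Summit.CriticalPhenomena.PercolationContinuityZ3.Theses
open Summit.CriticalPhenomena.PercolationContinuityZ3.Theorems.SurfaceTension

/-- **`ℤ³`: THE IIC TWO-POINT FUNCTION IS BOUNDED BELOW BY THE ONE-ARM PROBABILITY UNDER `CU⁺_l` + X_B** (`p_c(ℤ³)`, `l ≥ 2`, `c_U > 0`):
there are `n₀`, `c > 0` with `c·π_{p_c}(2n) ≤ ν(0 ↔ z inside Λ(2ln))` for every `z` with `‖z‖_∞ = n ≥ n₀` and every finite IIC measure `ν`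
((A2)□ from `CU⁺_l`, UAD from X_B). [cite: Kesten1986, Thm. (8)] [cite: BasuSapozhnikov2017ECP, Thm. 1.1] -/
theorem exists_le_iicMeasure_real_openConn_Z3_of_robustCondAnnulusUniq_of_critAnnulusNonCrossing {l : ℕ} (hl : 2 ≤ l) {cU : ℝ}
    (hcU : 0 < cU)
    (hCU : ∀ a : ℕ, 1 ≤ a → ∀ E : Set (BondConfig (Site 3)), IsUpperSet E → MeasurableSet E →
      cU * (bondPercolation (zdGraph 3) (criticalProbI 3)).real E ≤ (bondPercolation (zdGraph 3) (criticalProbI 3)).real (E ∩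
        {ω : BondConfig (Site 3) | ∀ t ∈ innerBoundary (zdGraph 3) (box 3 a), ∀ s ∈ innerBoundary (zdGraph 3) (box 3 (l * a)),
          ∀ t' ∈ innerBoundary (zdGraph 3) (box 3 a), ∀ s' ∈ innerBoundary (zdGraph 3) (box 3 (l * a)),
          ω ∈ openConnIn (↑((box 3 (l * a) \ box 3 a) ∪ innerBoundary (zdGraph 3) (box 3 a)) : Set (Site 3)) t s →
          ω ∈ openConnIn (↑((box 3 (l * a) \ box 3 a) ∪ innerBoundary (zdGraph 3) (box 3 a)) : Set (Site 3)) t' s' →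
          ω ∈ openConnIn (↑((box 3 (l * a) \ box 3 a) ∪ innerBoundary (zdGraph 3) (box 3 a)) : Set (Site 3)) s s'}))
    (hXB : PercAnnulusCrossing.CritAnnulusNonCrossing) :
    ∃ (n₀ : ℕ) (c : ℝ), 1 ≤ n₀ ∧ 0 < c ∧ ∀ (ν : Measure (BondConfig (Site 3))) [IsFiniteMeasure ν],
      (hν : ∀ (F : Finset (Sym2 (Site 3))) (E : Set (BondConfig (Site 3))), MeasurableSet E → DeterminedBy E ↑F →
      Tendsto (fun n : ℕ => (bondPercolation (zdGraph 3) (criticalProbI 3)).real (E ∩ siteToBoundary 3 n) /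
        oneArmProb 3 (criticalProbI 3) n) atTop (𝓝 (ν.real E))) →
      ∀ (n : ℕ) (z : Site 3), n₀ ≤ n → z ∈ sphere 3 n →
        c * oneArmProb 3 (criticalProbI 3) (2 * n) ≤ ν.real (openConnIn (↑(box 3 (2 * l * n)) : Set (Site 3)) 0 z) :=
  exists_le_iicMeasure_real_openConnIn_criticalProbI_of_robustCondAnnulusUniq (d := 3) (by norm_num) hl hcU hCU
    (uad_of_critAnnulusNonCrossing hXB)

/-- **`ℤ³`: RUNS OF NON-GLUED ANNULI IN THE IIC ARE EXPONENTIALLY RARE UNDER `CU⁺_l(c)`** (`p_c(ℤ³)`, `l ≥ 2`; nested scales `a_i ≥ 1`,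
`l·a_i + 1 ≤ a_{i+1}`; every finite IIC measure `ν`): `ν(⋂_{i<j} U(a_i, la_i)ᶜ) ≤ (1 − c)^j`. [cite: Kesten1986, §2] -/
theorem iicMeasure_real_iInter_compl_annulusUniq_le_pow_Z3 {l : ℕ} (hl : 2 ≤ l) {cU : ℝ}
    (hCU : ∀ a : ℕ, 1 ≤ a → ∀ E : Set (BondConfig (Site 3)), IsUpperSet E → MeasurableSet E →
      cU * (bondPercolation (zdGraph 3) (criticalProbI 3)).real E ≤ (bondPercolation (zdGraph 3) (criticalProbI 3)).real (E ∩
        {ω : BondConfig (Site 3) | ∀ t ∈ innerBoundary (zdGraph 3) (box 3 a), ∀ s ∈ innerBoundary (zdGraph 3) (box 3 (l * a)),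
          ∀ t' ∈ innerBoundary (zdGraph 3) (box 3 a), ∀ s' ∈ innerBoundary (zdGraph 3) (box 3 (l * a)),
          ω ∈ openConnIn (↑((box 3 (l * a) \ box 3 a) ∪ innerBoundary (zdGraph 3) (box 3 a)) : Set (Site 3)) t s →
          ω ∈ openConnIn (↑((box 3 (l * a) \ box 3 a) ∪ innerBoundary (zdGraph 3) (box 3 a)) : Set (Site 3)) t' s' →
          ω ∈ openConnIn (↑((box 3 (l * a) \ box 3 a) ∪ innerBoundary (zdGraph 3) (box 3 a)) : Set (Site 3)) s s'}))
    (a : ℕ → ℕ) (ha1 : ∀ i, 1 ≤ a i) (hnest : ∀ i, l * a i + 1 ≤ a (i + 1))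
    {ν : Measure (BondConfig (Site 3))} [IsFiniteMeasure ν]
    (hν : ∀ (F : Finset (Sym2 (Site 3))) (E : Set (BondConfig (Site 3))), MeasurableSet E → DeterminedBy E ↑F →
      Tendsto (fun n : ℕ => (bondPercolation (zdGraph 3) (criticalProbI 3)).real (E ∩ siteToBoundary 3 n) /
        oneArmProb 3 (criticalProbI 3) n) atTop (𝓝 (ν.real E))) (j : ℕ) :
    ν.real (⋂ i ∈ Finset.range j,
        {ω : BondConfig (Site 3) | ∀ t ∈ innerBoundary (zdGraph 3) (box 3 (a i)), ∀ s ∈ innerBoundary (zdGraph 3) (box 3 (l * a i)),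
          ∀ t' ∈ innerBoundary (zdGraph 3) (box 3 (a i)), ∀ s' ∈ innerBoundary (zdGraph 3) (box 3 (l * a i)),
          ω ∈ openConnIn (↑((box 3 (l * a i) \ box 3 (a i)) ∪ innerBoundary (zdGraph 3) (box 3 (a i))) : Set (Site 3)) t s →
          ω ∈ openConnIn (↑((box 3 (l * a i) \ box 3 (a i)) ∪ innerBoundary (zdGraph 3) (box 3 (a i))) : Set (Site 3)) t' s' →
          ω ∈ openConnIn (↑((box 3 (l * a i) \ box 3 (a i)) ∪ innerBoundary (zdGraph 3) (box 3 (a i))) : Set (Site 3)) s s'}ᶜ) ≤ (1 - cU) ^ j :=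
  iicMeasure_real_iInter_compl_annulusUniq_le_pow (criticalProbI 3) hl hCU a ha1 hnest hν j

end Summit.CriticalPhenomena.PercolationContinuityZ3.Theorems.Crossing

end
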